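import Summits.BirchSwinnertonDyer.Rank1Residual.Additive.TameBranchAnalyticShaRankOne
import Summits.BirchSwinnertonDyer.Rank1Residual.Additive.TameBranchAnalyticShaConverse
import Summits.BirchSwinnertonDyer.Rank1Residual.Additive.QuadraticTwistSurj
import Literature.NumberTheory.EllipticCurves.Wuthrich2014.ThreeAdicImageOrdinaryProofs
import HarnessLib

/-!
# `BSD(E,p)` ⟺ THE MAIN CONJECTURE AT THE PAIR AT RANK ONE, GIVEN the branch `p`-adic Gross–Zagier
# formula — the upper half WITH `ℓ`, `ord_p #Ш[p^∞] + ord_p ℓ ≤ ord_p #Ш_an`, holds on every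
# rank-one row, `=` iff the Kato element GENERATES `char_Λ X(E/ℚ_∞)` (every odd `p`, (B)-datum a binder)
# (cell `b2b-bsdres`, sub-cell additive-p2 = X3♯(G-ord)/X4♯(G-ord), gen 33; part 3)

HONEST FRAMING (cell `b2b-bsdres`, run/shared/lean/b2b/bsd-rank1-residual/, verbatim in every
file): the goal of the cell is to DELETE the COMBINATION-SHAPED residual classes of the
Birch–Swinnerton-Dyer formula for ALL analytic-rank `≤ 1` elliptic curves over `ℚ` — "full BSD
formula for every rank `≤ 1` curve in class `C`" assembled STRICTLY from published theorems — so
that the rank-`≤ 1` remainder becomes exactly the CONSTRUCTION-SHAPED classes, which are TYPED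
(missing-input `Prop`s), NOT attempted. This is not "finishing BSD". Sub-cell additive-p2: the
classes X3♯(G-ord) / X4♯(G-ord) are CONSTRUCTION-SHAPED and stay so; labels / RESIDUAL-MAP marks
UNCHANGED; nothing is booked (`BSD(E,p)`, the lower bound, and n1011-p01's TYPED, conjecture-tagged
branch `p`-adic Gross–Zagier formula `BranchPAdicGrossZagier[Odd]At` — NOT in print at `p² ∣ N` — enter
ONLY as hypotheses). Theorems only; published inputs are explicit binders (`hK` Kato 2004 Thm. 17.4 (3),
`hGZK`, the (B)-datum `LeadingTermClauses W p Dh`). No definition, no named fact, no `sorry`.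

## What and why

Gen 32 proved the CONVERSE dichotomy at rank 0 only (part 6: `ord_p #Ш[p^∞] + ord_p ℓ ≤ ord_p #Ш_an`,
`=` ⟺ the Kato element generates). §1 is its RANK-ONE twin per cyclotomic datum (series-agnostic):
for `rank_ℤ E(ℚ) = 1`, a (B)-datum, ANY `g ∈ char_Λ X` with `ι g = X` and `[T¹]X ≠ 0`: Schneider,
`#Ш[p^∞] < ∞`, and Delbourgo's `ℓ ∣ p²` has **`ord_p #Ш[p^∞] + ord_p Reg_p(E,Dh) + ord_p ∏c + ord_p ℓ ≤
v_p([T¹]X) + 1 + 2·ord_p #tors`, EQUALITY ⟺ `char_Λ X = (g)`** (gen 29's rank-one inequality on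
`B := ι(pfree g)` with the first top AUTOMATIC at `λ(g)` + Greenberg–Vatsal's "`(g') = (g) ⟺ μ, λ agree`").
§2 (X4♯(G-ord, `e = 2`) ∩ {`ρ̄` onto}, EVERY odd `p`, (B)-datum a binder, tower of the twist by
lit-kato's proved case of Wuthrich's Lemma 20): GIVEN `BranchPAdicGrossZagier[Odd]At W p Dh`, the
`T¹`-dictionary `v_p([T¹](ϖB^±)) + 1 + 2t = ord_p #Ш_an + ord_p ∏c + ord_p Reg_p` (gen 32 part 3 §3)
turns §1 into **`ord_p #Ш(E/ℚ)[p^∞] + ord_p ℓ ≤ ord_p #Ш_an(E)`, `=` ⟺ `char_Λ X = (Kato element)`**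
(`ClassX4Gord.padicVal_sha_add_le_shaAn_and_iff_rankOne_of_branchPAdicGrossZagier`) — so, exactly as at
rank 0: **`BSD(E,p)` ⟹ MC(pair)** (`…charIdeal_eq_span_kato_of_bsdp_rankOne_…`), **MC(pair) ⟹ `BSD(E,p)`
off the anomalous rows** (`…bsdp_of_charIdeal_eq_span_kato_rankOne_…`), and **a LOWER bound
`ord_p #Ш_an ≤ ord_p #Ш[p^∞]` ⟹ `BSD(E,p)` ∧ MC(pair) ∧ `ℓ = 1`** (`…of_shaAn_le_card_rankOne_…`). The
rank-one per-pair data are `[T¹](ϖ·B^±) ≠ 0` (simple analytic zero of the branch; census: A′ ≠ 0 on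
429/429 X4-2 WINDOW rows) and Cremona's `#Ш_an`; the located gap at rank 1 stays the branch `p`-adic
Gross–Zagier formula and `Reg_p ↔ h` (BSD_p at rank 1 is NOT claimed). Nothing booked.

References: Kato 2004 Thm. 17.4 (3) [Kato2004Asterisque]; Delbourgo 2002 Thm. (A), (B) [Delbourgo2002];
Delbourgo 1998 §2.5 (shape of pGZ) [Delbourgo1998]; Greenberg–Vatsal 2000 p. 4 [GreenbergVatsal2000];
Washington GTM 83 §7.1 [Washington1997]; Wuthrich 2014 Lemma 20 [Wuthrich2014]; Miller 2011 Def. 1.1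
[Miller2011LMS]; gen 29 `TameBranchExtraZerosRankOne`, gen 32 parts 1, 3, 6. -/

set_option autoImplicit false

noncomputable section

open scoped Classical MatrixGroups ModularForm NumberField

open CongruenceSubgroup IsDedekindDomain WeierstrassCurve NumberField
  Literature.NumberTheory.EllipticCurves
  Literature.NumberTheory.EllipticCurves.ModularForms
  Literature.NumberTheory.EllipticCurves.Rank1Residual
  Literature.NumberTheory.EllipticCurves.Rank1Residual.Typed
  Literature.NumberTheory.EllipticCurves.Delbourgo2002
  Literature.NumberTheory.GaloisRepresentations
  Summit.BirchSwinnertonDyer.Rank1Residual.AdditivePotMult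
  Summit.BirchSwinnertonDyer.Rank1Residual.X1.MuLambda
  Summit.BirchSwinnertonDyer.Rank1Residual.X1.RankOneParitySqueeze
  Summit.BirchSwinnertonDyer.Rank1Residual.X11a.LambdaNorm

namespace Summit.BirchSwinnertonDyer.Rank1Residual.Additive

/-! ### §1 Per datum, rank one: the upper half WITH `ℓ`, EQUALITY iff the Kato element generates -/

namespace TameBranchAnalyticSha

open TameBranchExtraZeros

variable {W : WeierstrassCurve ℚ} [W.IsElliptic] {p : ℕ} [hp : Fact p.Prime]

/-- **Per datum (rank 1): `ord_p #Ш[p^∞] + ord_p Reg_p + ord_p ∏c + ord_p ℓ ≤ v_p([T¹]X) + 1 + 2·ord_p #tors`,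
EQUALITY iff `char_Λ X = (g)`.** `p ≠ 2`, `rank_ℤ E(ℚ) = 1`, a (B)-datum `Dh`, a cyclotomic dual datum with
`X` torsion and generator `fE`, ANY `g ∈ char_Λ X` with `ι g = X` and `[T¹]X ≠ 0`. Then Schneider's
conjecture holds for `Dh`, `Ш[p^∞]` is finite, and Delbourgo's clause 3 supplies `ℓ ∣ p²` (`= 1` off the
anomalous rows) with the displayed inequality and equivalence: gen 29's rank-one inequality on
`B := ι(pfree g)` (first top AUTOMATIC at `λ(g)`, `μ(fE) ≤ μ(g)` from `fE ∣ g`) and Greenberg–Vatsal's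
"`(g') = (g) ⟺ μ, λ agree`". [cite: Delbourgo2002, Theorem (B) (p. 40)]
[cite: GreenbergVatsal2000, p. 4 (after Thm. (1.2))] [cite: Washington1997, §7.1] -/
theorem charIdeal_eq_span_iff_valuation_eq_rankOne_of_iota_eq (hp2 : p ≠ 2)
    (hr1 : W.mordellWeilRank = 1) {Dh : PAdicHeightData W p} (hBcl : LeadingTermClauses W p Dh)
    {κ : ZpExtension ℚ p} {γ : Field.absoluteGaloisGroup ℚ}
    (hκ : κ.IsCyclotomic) (hγ : κ.IsTopGenerator γ) (hγ' : IsCyclotomicVariable p γ)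
    (D : W.SelmerDualData κ γ) [Module.Finite (IwasawaAlgebra p) D.X] (hX : D.IsTorsion)
    {fE g : IwasawaAlgebra p} (hchar : D.charIdeal = Ideal.span {fE}) (hg : g ∈ D.charIdeal)
    {X : PowerSeries ℚ_[p]} (hι : iwasawaToPowerSeries p g = X)
    (hX1 : PowerSeries.coeff 1 X ≠ 0) :
    SchneiderConjecture Dh ∧ Finite (AddCommGroup.primaryComponent W.sha p) ∧
      ∃ ℓ : ℕ, ℓ ∣ p ^ 2 ∧ (ReductionNonAnomalous W p → ℓ = 1) ∧
        (padicValNat p (Nat.card (AddCommGroup.primaryComponent W.sha p)) : ℤ) +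
            (padicRegulator Dh).valuation + padicValNat p W.tamagawaProduct + padicValNat p ℓ ≤
          (PowerSeries.coeff 1 X).valuation + 1 + 2 * padicValNat p W.torsionOrder ∧
        (D.charIdeal = Ideal.span {g} ↔
          (padicValNat p (Nat.card (AddCommGroup.primaryComponent W.sha p)) : ℤ) +
              (padicRegulator Dh).valuation + padicValNat p W.tamagawaProduct + padicValNat p ℓ =
            (PowerSeries.coeff 1 X).valuation + 1 + 2 * padicValNat p W.torsionOrder) := by
  have hg0 : g ≠ 0 := by intro h0; apply hX1; rw [← hι, h0, map_zero, map_zero]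
  have hιB := iota_eq_C_pow_mu_mul_iota_pfree (p := p) g
  have hbd := norm_coeff_iota_pfree_le (p := p) g
  obtain ⟨hn, hlt⟩ := firstTop_iota_pfree (p := p) hg0
  obtain ⟨hB1, hvX⟩ := valuation_coeff_iota_eq_mu_add hι (j := 1) hX1
  -- the factorisation `g = fE · h`
  have hg' := hg
  rw [hchar] at hg'
  obtain ⟨h, hh⟩ := Ideal.mem_span_singleton'.mp hg'
  have hfac : g = fE * h := by rw [← hh, mul_comm]
  have hfE0 : fE ≠ 0 := by intro e; apply hg0; rw [hfac, e, zero_mul]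
  have hμle : mu fE ≤ mu g := mu_le_mu_of_mem_span hg' hg0
  obtain ⟨hS, hfin, -, -, ℓ, hℓp, hℓ1, hle, hiff⟩ :=
    schneider_and_padicVal_le_rankOne_of_iota_eq_of_firstTop hp2 hr1 hBcl hκ hγ hγ' D hX hchar hg hιB hbd
      hn hlt hB1
  simp only [Nat.cast_zero, add_zero] at hle hiff
  have hμle' : (mu fE : ℤ) ≤ mu g := by exact_mod_cast hμle
  refine ⟨hS, hfin, ℓ, hℓp, hℓ1, by rw [hvX]; linarith, ?_⟩
  rw [hvX, hchar]
  constructor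
  · -- `(fE) = (g)` ⟹ `μ, λ` agree ⟹ equality
    intro hspan
    obtain ⟨hμ, hlam⟩ := (span_eq_span_iff_mu_lam hfE0 hg0 hfac).mp hspan.symm
    have e := hiff.mpr hlam.symm
    rw [hμ]
    linarith
  · -- equality ⟹ `μ(fE) = μ(g)` (the chain is tight) and `λ(fE) = λ(g)` (gen 29's criterion)
    intro heq
    have hμeq : (mu fE : ℤ) = mu g := by linarith
    have hlam : lam fE = lam g := hiff.mp (by linarith)
    have hμeq' : mu fE = mu g := by exact_mod_cast hμeq
    exact ((span_eq_span_iff_mu_lam hfE0 hg0 hfac).mpr ⟨hμeq'.symm, hlam.symm⟩).symm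

end TameBranchAnalyticSha

/-! ### §2 X4♯(G-ord, `e = 2`) ∩ {`ρ̄` onto}, rank 1, every odd `p`, GIVEN the branch `p`-adic Gross–Zagier formula -/

section ClassLevel

open TameBranchMuPart TameBranchAnalyticSha

variable {W : WeierstrassCurve ℚ} [W.IsElliptic] [W.IsGloballyMinimal] {p : ℕ} [hp : Fact p.Prime]

omit [W.IsGloballyMinimal] in
/-- **THE UPPER HALF WITH `ℓ` AT RANK ONE, AND ITS EQUALITY CASE (GIVEN the branch pGZ).** X4♯(G-ord)
∩ {`ρ̄_{E,p}` onto}, `p` odd, `rank_ℤ E(ℚ) = 1`, `#Ш_an(E) = s ∈ ℚ`, a (B)-datum `Dh` for which the TYPED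
`BranchPAdicGrossZagier[Odd]At W p Dh` hold; twist data `(V, C, f, ϖ)` (`V = E♭` good ordinary,
`C • V^{(p*)} = W`, `f` newform of `V`, `ϖ` period ratio) with **`[T¹](ϖ·B^±) ≠ 0`**. Then for every
cyclotomic dual datum: `X` torsion, Schneider, `Ш[p^∞]` finite, and there are the Kato element `g`
(`ι g = u·ϖ·B^±`) and Delbourgo's `ℓ ∣ p²` (`= 1` off the anomalous rows) with
**`ord_p #Ш(E/ℚ)[p^∞] + ord_p ℓ ≤ ord_p s`, EQUALITY ⟺ `char_Λ X = (g)`**. The pGZ formula is a typed,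
conjecture-tagged input (NOT in print); nothing booked. [cite: Kato2004Asterisque, Thm. 17.4 (3) (p. 273)]
[cite: Delbourgo2002, Theorem (B) (p. 40)] [cite: Delbourgo1998, §2.5 BS-D(p) (ii) (shape only)]
[cite: GreenbergVatsal2000, p. 4] [cite: Miller2011LMS, §1 (arXiv:1010.2431 p. 3)] -/
theorem ClassX4Gord.padicVal_sha_add_le_shaAn_and_iff_rankOne_of_branchPAdicGrossZagier
    (hK : Wuthrich2014.kato_halfEigenCharIdeal_dvd_cyclotomicPrime_of_surjective)
    (hX : ClassX4Gord W p) (hsurj : Surj W p) (hr1 : W.mordellWeilRank = 1)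
    {Dh : PAdicHeightData W p} (hBcl : LeadingTermClauses W p Dh)
    (hGZe : BranchPAdicGrossZagierAt W p Dh) (hGZo : BranchPAdicGrossZagierOddAt W p Dh)
    {s : ℚ} (hs : shaAn W = (s : ℂ))
    (V : WeierstrassCurve ℚ) [V.IsElliptic] [V.IsGloballyMinimal] (C : VariableChange ℚ)
    (hC : C • V.quadraticTwist ((-1 : ℚ) ^ (p / 2) * p) = W) (hV : GoodOrd V p)
    {N : ℕ} [NeZero N] {f : CuspForm (Gamma0 N) 2} (hf : IsNewformOf V f)
    (ϖ : ℚ) (hϖ : if Even (p / 2) then (ϖ : ℝ) * V.realPeriodRat = plusPeriod f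
      else (ϖ : ℝ) * V.imaginaryPeriodRat = minusPeriod f)
    (h1 : PowerSeries.coeff 1 (PowerSeries.C (ϖ : ℚ_[p]) *
      (if Even (p / 2) then padicLFunctionBranch f ((unitRoot V p : ℤ_[p]) : ℚ_[p]) (p / 2)
        else padicLFunctionMinusBranch f ((unitRoot V p : ℤ_[p]) : ℚ_[p]) (p / 2))) ≠ 0)
    {κ : ZpExtension ℚ p} {γ : Field.absoluteGaloisGroup ℚ}
    (hκ : κ.IsCyclotomic) (hγ : κ.IsTopGenerator γ) (hγ' : IsCyclotomicVariable p γ)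
    (D : W.SelmerDualData κ γ) :
    D.IsTorsion ∧ SchneiderConjecture Dh ∧ Finite (AddCommGroup.primaryComponent W.sha p) ∧
      ∃ (g : IwasawaAlgebra p) (u : ℤ_[p]ˣ) (ℓ : ℕ), g ∈ D.charIdeal ∧
        iwasawaToPowerSeries p g = PowerSeries.C (((u : ℤ_[p]) : ℚ_[p]) * (ϖ : ℚ_[p])) *
          (if Even (p / 2) then padicLFunctionBranch f ((unitRoot V p : ℤ_[p]) : ℚ_[p]) (p / 2)
            else padicLFunctionMinusBranch f ((unitRoot V p : ℤ_[p]) : ℚ_[p]) (p / 2)) ∧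
        ℓ ∣ p ^ 2 ∧ (ReductionNonAnomalous W p → ℓ = 1) ∧
        (padicValNat p (Nat.card (AddCommGroup.primaryComponent W.sha p)) : ℤ) + padicValNat p ℓ ≤
          padicValRat p s ∧
        (D.charIdeal = Ideal.span {g} ↔
          (padicValNat p (Nat.card (AddCommGroup.primaryComponent W.sha p)) : ℤ) + padicValNat p ℓ =
            padicValRat p s) := by
  have hp2 : p ≠ 2 := hX.addv.1
  have hj := padicValRat_j_nonneg_of_typeGOrd W p hX.typeGOrd
  have hsV : Surj V p := (surj_iff_of_model_twist V p (pStar_ne_zero p) ⟨C, hC⟩).mp hsurj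
  have hsurjV : ∀ m : ℕ, V.HasSurjectiveModNGaloisRep (p ^ m : ℕ) := fun m ↦
    V.forall_hasSurjectiveModNGaloisRep_pow_of_goodOrdinary_of_surj p hp2 hV.1 hV.2 hsV m
  haveI : Module.Finite (IwasawaAlgebra p) D.X :=
    SelmerDualData.module_finite_of_isCyclotomic (W := W) (κ := κ) hκ D hγ
  obtain ⟨hXt, g, hg, u, hι⟩ := isTorsion_and_exists_iota_eq_branch_of_katoComponent W p
    (Kato2004.charIdeal_dvd_padicLFunctionBranch_component_of_surjective_of_half hK) hj hp2 V
    ⟨C, hC⟩ (Or.inl hV) hsurjV hκ hγ hγ' hf D ϖ hϖ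
  have hX1 : PowerSeries.coeff 1 (PowerSeries.C (((u : ℤ_[p]) : ℚ_[p]) * (ϖ : ℚ_[p])) *
      (if Even (p / 2) then padicLFunctionBranch f ((unitRoot V p : ℤ_[p]) : ℚ_[p]) (p / 2)
        else padicLFunctionMinusBranch f ((unitRoot V p : ℤ_[p]) : ℚ_[p]) (p / 2))) ≠ 0 := by
    rw [PowerSeries.coeff_C_mul, mul_assoc]
    rw [PowerSeries.coeff_C_mul] at h1
    exact mul_ne_zero (coe_units_ne_zero p u) h1
  -- the `T¹`-dictionary under pGZ
  obtain ⟨-, hdict⟩ := valuation_coeff_one_branch_add_eq_of_branchPAdicGrossZagier hp2 hr1 hGZe hGZo V C hC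
    hV hf ϖ hϖ h1 hs
  have hvu := valuation_coeff_C_unit_mul u (ϖ : ℚ_[p]) _ 1 h1
  haveI : (Literature.NumberTheory.EllipticCurves.Module.charIdeal (IwasawaAlgebra p) D.X).IsPrincipal :=
    charIdeal_isPrincipal_holds p D.X
  obtain ⟨fE, hchar⟩ := Submodule.IsPrincipal.principal
    (Literature.NumberTheory.EllipticCurves.Module.charIdeal (IwasawaAlgebra p) D.X)
  obtain ⟨hS, hfin, ℓ, hℓp, hℓ1, hle, hiff⟩ := charIdeal_eq_span_iff_valuation_eq_rankOne_of_iota_eq hp2 hr1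
    hBcl hκ hγ hγ' D hXt hchar hg hι hX1
  rw [hvu] at hle hiff
  refine ⟨hXt, hS, hfin, g, u, ℓ, hg, hι, hℓp, hℓ1, by linarith, ?_⟩
  rw [hiff]
  constructor <;> intro e <;> linarith

omit [W.IsGloballyMinimal] in
/-- **RANK ONE: `BSD(E,p)` ⟹ THE MAIN CONJECTURE AT THE PAIR (GIVEN the branch pGZ).** Same rows and data;
IF Miller's `BSD(E,p)` holds, then for every cyclotomic dual datum the Kato element `g` generates
`char_Λ X(E/ℚ_∞)` (with Schneider for `Dh`). `BSD(E,p)` and pGZ are HYPOTHESES; nothing booked.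
[cite: Kato2004Asterisque, Thm. 17.4 (3) (p. 273)] [cite: Delbourgo2002, Theorem (B) (p. 40)]
[cite: Miller2011LMS, Def. 1.1 (arXiv:1010.2431 p. 3)] -/
theorem ClassX4Gord.charIdeal_eq_span_kato_of_bsdp_rankOne_of_branchPAdicGrossZagier
    (hK : Wuthrich2014.kato_halfEigenCharIdeal_dvd_cyclotomicPrime_of_surjective)
    (hX : ClassX4Gord W p) (hsurj : Surj W p) (hr : W.analyticRank = 1) (hBSD : BSDp W p)
    {Dh : PAdicHeightData W p} (hBcl : LeadingTermClauses W p Dh)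
    (hGZe : BranchPAdicGrossZagierAt W p Dh) (hGZo : BranchPAdicGrossZagierOddAt W p Dh)
    (V : WeierstrassCurve ℚ) [V.IsElliptic] [V.IsGloballyMinimal] (C : VariableChange ℚ)
    (hC : C • V.quadraticTwist ((-1 : ℚ) ^ (p / 2) * p) = W) (hV : GoodOrd V p)
    {N : ℕ} [NeZero N] {f : CuspForm (Gamma0 N) 2} (hf : IsNewformOf V f)
    (ϖ : ℚ) (hϖ : if Even (p / 2) then (ϖ : ℝ) * V.realPeriodRat = plusPeriod f
      else (ϖ : ℝ) * V.imaginaryPeriodRat = minusPeriod f)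
    (h1 : PowerSeries.coeff 1 (PowerSeries.C (ϖ : ℚ_[p]) *
      (if Even (p / 2) then padicLFunctionBranch f ((unitRoot V p : ℤ_[p]) : ℚ_[p]) (p / 2)
        else padicLFunctionMinusBranch f ((unitRoot V p : ℤ_[p]) : ℚ_[p]) (p / 2))) ≠ 0)
    {κ : ZpExtension ℚ p} {γ : Field.absoluteGaloisGroup ℚ}
    (hκ : κ.IsCyclotomic) (hγ : κ.IsTopGenerator γ) (hγ' : IsCyclotomicVariable p γ)
    (D : W.SelmerDualData κ γ) :
    SchneiderConjecture Dh ∧ ∃ (g : IwasawaAlgebra p) (u : ℤ_[p]ˣ), D.charIdeal = Ideal.span {g} ∧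
      iwasawaToPowerSeries p g = PowerSeries.C (((u : ℤ_[p]) : ℚ_[p]) * (ϖ : ℚ_[p])) *
        (if Even (p / 2) then padicLFunctionBranch f ((unitRoot V p : ℤ_[p]) : ℚ_[p]) (p / 2)
          else padicLFunctionMinusBranch f ((unitRoot V p : ℤ_[p]) : ℚ_[p]) (p / 2)) := by
  obtain ⟨hmw, -, s, hs, hsv⟩ := hBSD
  have hr1 : W.mordellWeilRank = 1 := by rw [hmw, hr]
  obtain ⟨-, hS, -, g, u, ℓ, -, hι, -, -, hle, hiff⟩ :=
    hX.padicVal_sha_add_le_shaAn_and_iff_rankOne_of_branchPAdicGrossZagier hK hsurj hr1 hBcl hGZe hGZo hs V C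
      hC hV hf ϖ hϖ h1 hκ hγ hγ' D
  have hℓ0 : (padicValNat p ℓ : ℤ) = 0 := by
    have h0 : (0 : ℤ) ≤ padicValNat p ℓ := by exact_mod_cast Nat.zero_le _
    rw [hsv] at hle; linarith
  exact ⟨hS, g, u, hiff.mpr (by rw [hsv, hℓ0, add_zero]), hι⟩

omit [W.IsGloballyMinimal] in
/-- **RANK ONE, OFF THE ANOMALOUS ROWS: THE MAIN CONJECTURE AT THE PAIR ⟹ `BSD(E,p)` (GIVEN the branch
pGZ).** Same rows, non-anomalous (Delbourgo's `ℓ_p = 1`); IF for every cyclotomic dual datum every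
Kato-shaped element (`g ∈ char_Λ X`, `ι g = u·ϖ·B^±`) generates `char_Λ X(E/ℚ_∞)`, then `BSD(E,p)` holds
(GZK supplies `rank = r_an = 1`). [cite: Kato2004Asterisque, Thm. 17.4 (3) (p. 273)]
[cite: Delbourgo2002, Theorem (B) (p. 40)] [cite: Miller2011LMS, Def. 1.1 (arXiv:1010.2431 p. 3)] -/
theorem ClassX4Gord.bsdp_of_charIdeal_eq_span_kato_rankOne_of_branchPAdicGrossZagier
    (hK : Wuthrich2014.kato_halfEigenCharIdeal_dvd_cyclotomicPrime_of_surjective)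
    (hGZK : rank_eq_analyticRank_of_analyticRank_le_one)
    (hX : ClassX4Gord W p) (hsurj : Surj W p) (hr : W.analyticRank = 1) (hna : ReductionNonAnomalous W p)
    {Dh : PAdicHeightData W p} (hBcl : LeadingTermClauses W p Dh)
    (hGZe : BranchPAdicGrossZagierAt W p Dh) (hGZo : BranchPAdicGrossZagierOddAt W p Dh)
    {s : ℚ} (hs : shaAn W = (s : ℂ))
    (V : WeierstrassCurve ℚ) [V.IsElliptic] [V.IsGloballyMinimal] (C : VariableChange ℚ)
    (hC : C • V.quadraticTwist ((-1 : ℚ) ^ (p / 2) * p) = W) (hV : GoodOrd V p)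
    {N : ℕ} [NeZero N] {f : CuspForm (Gamma0 N) 2} (hf : IsNewformOf V f)
    (ϖ : ℚ) (hϖ : if Even (p / 2) then (ϖ : ℝ) * V.realPeriodRat = plusPeriod f
      else (ϖ : ℝ) * V.imaginaryPeriodRat = minusPeriod f)
    (h1 : PowerSeries.coeff 1 (PowerSeries.C (ϖ : ℚ_[p]) *
      (if Even (p / 2) then padicLFunctionBranch f ((unitRoot V p : ℤ_[p]) : ℚ_[p]) (p / 2)
        else padicLFunctionMinusBranch f ((unitRoot V p : ℤ_[p]) : ℚ_[p]) (p / 2))) ≠ 0)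
    (hMC : ∀ (κ : ZpExtension ℚ p) (γ : Field.absoluteGaloisGroup ℚ),
      κ.IsCyclotomic → κ.IsTopGenerator γ → IsCyclotomicVariable p γ → ∀ (D : W.SelmerDualData κ γ)
      (g : IwasawaAlgebra p) (u : ℤ_[p]ˣ), g ∈ D.charIdeal →
        iwasawaToPowerSeries p g = PowerSeries.C (((u : ℤ_[p]) : ℚ_[p]) * (ϖ : ℚ_[p])) *
          (if Even (p / 2) then padicLFunctionBranch f ((unitRoot V p : ℤ_[p]) : ℚ_[p]) (p / 2)
            else padicLFunctionMinusBranch f ((unitRoot V p : ℤ_[p]) : ℚ_[p]) (p / 2)) →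
        D.charIdeal = Ideal.span {g}) :
    BSDp W p := by
  obtain ⟨hmw, -⟩ := hGZK W (by rw [hr])
  have hr1 : W.mordellWeilRank = 1 := by rw [hmw, hr]
  obtain ⟨κ₀, γ₀, hκ₀, hγ₀, hγ₀', D₀, -, -⟩ := exists_cyclotomic_dualData_generator W p
  obtain ⟨-, -, hfin, g, u, ℓ, hg, hι, -, hℓ1, -, hiff⟩ :=
    hX.padicVal_sha_add_le_shaAn_and_iff_rankOne_of_branchPAdicGrossZagier hK hsurj hr1 hBcl hGZe hGZo hs V C
      hC hV hf ϖ hϖ h1 hκ₀ hγ₀ hγ₀' D₀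
  have heq := hiff.mp (hMC κ₀ γ₀ hκ₀ hγ₀ hγ₀' D₀ g u hg hι)
  rw [hℓ1 hna, padicValNat_one_right, Nat.cast_zero, add_zero] at heq
  exact ⟨hmw, hfin, s, hs, heq.symm⟩

omit [W.IsGloballyMinimal] in
/-- **RANK ONE: A LOWER BOUND ON `#Ш(E)[p^∞]` CLOSES THE CHAIN (GIVEN the branch pGZ).** Same rows and
data; IF `ord_p #Ш_an(E) ≤ ord_p #Ш(E/ℚ)[p^∞]`, then **`BSD(E,p)`**, **`ord_p #Ш[p^∞] = ord_p #Ш_an`**, and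
for every cyclotomic dual datum the Kato element generates `char_Λ X(E/ℚ_∞)` with Delbourgo's `ℓ = 1`.
(Census: all 480 rank-1 defect-2 window rows have `p ∤ #Ш_an`, where the bound is vacuous and gen 32's
part 3 §3 applies.) [cite: Kato2004Asterisque, Thm. 17.4 (3) (p. 273)] [cite: Delbourgo2002, Theorem (B) (p. 40)]
[cite: Miller2011LMS, Def. 1.1 (arXiv:1010.2431 p. 3)] -/
theorem ClassX4Gord.bsdp_and_charIdeal_eq_span_kato_of_shaAn_le_card_rankOne_of_branchPAdicGrossZagier
    (hK : Wuthrich2014.kato_halfEigenCharIdeal_dvd_cyclotomicPrime_of_surjective)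
    (hGZK : rank_eq_analyticRank_of_analyticRank_le_one)
    (hX : ClassX4Gord W p) (hsurj : Surj W p) (hr : W.analyticRank = 1)
    {Dh : PAdicHeightData W p} (hBcl : LeadingTermClauses W p Dh)
    (hGZe : BranchPAdicGrossZagierAt W p Dh) (hGZo : BranchPAdicGrossZagierOddAt W p Dh)
    {s : ℚ} (hs : shaAn W = (s : ℂ))
    (hlow : padicValRat p s ≤ padicValNat p (Nat.card (AddCommGroup.primaryComponent W.sha p)))
    (V : WeierstrassCurve ℚ) [V.IsElliptic] [V.IsGloballyMinimal] (C : VariableChange ℚ)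
    (hC : C • V.quadraticTwist ((-1 : ℚ) ^ (p / 2) * p) = W) (hV : GoodOrd V p)
    {N : ℕ} [NeZero N] {f : CuspForm (Gamma0 N) 2} (hf : IsNewformOf V f)
    (ϖ : ℚ) (hϖ : if Even (p / 2) then (ϖ : ℝ) * V.realPeriodRat = plusPeriod f
      else (ϖ : ℝ) * V.imaginaryPeriodRat = minusPeriod f)
    (h1 : PowerSeries.coeff 1 (PowerSeries.C (ϖ : ℚ_[p]) *
      (if Even (p / 2) then padicLFunctionBranch f ((unitRoot V p : ℤ_[p]) : ℚ_[p]) (p / 2)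
        else padicLFunctionMinusBranch f ((unitRoot V p : ℤ_[p]) : ℚ_[p]) (p / 2))) ≠ 0)
    {κ : ZpExtension ℚ p} {γ : Field.absoluteGaloisGroup ℚ}
    (hκ : κ.IsCyclotomic) (hγ : κ.IsTopGenerator γ) (hγ' : IsCyclotomicVariable p γ)
    (D : W.SelmerDualData κ γ) :
    BSDp W p ∧ (padicValNat p (Nat.card (AddCommGroup.primaryComponent W.sha p)) : ℤ) = padicValRat p s ∧
      ∃ (g : IwasawaAlgebra p) (u : ℤ_[p]ˣ) (ℓ : ℕ), D.charIdeal = Ideal.span {g} ∧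
        iwasawaToPowerSeries p g = PowerSeries.C (((u : ℤ_[p]) : ℚ_[p]) * (ϖ : ℚ_[p])) *
          (if Even (p / 2) then padicLFunctionBranch f ((unitRoot V p : ℤ_[p]) : ℚ_[p]) (p / 2)
            else padicLFunctionMinusBranch f ((unitRoot V p : ℤ_[p]) : ℚ_[p]) (p / 2)) ∧
        ℓ ∣ p ^ 2 ∧ ℓ = 1 ∧
        (padicValNat p (Nat.card (AddCommGroup.primaryComponent W.sha p)) : ℤ) + padicValNat p ℓ =
          padicValRat p s := by
  obtain ⟨hmw, -⟩ := hGZK W (by rw [hr])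
  have hr1 : W.mordellWeilRank = 1 := by rw [hmw, hr]
  obtain ⟨-, -, hfin, g, u, ℓ, -, hι, hℓp, -, hle, hiff⟩ :=
    hX.padicVal_sha_add_le_shaAn_and_iff_rankOne_of_branchPAdicGrossZagier hK hsurj hr1 hBcl hGZe hGZo hs V C
      hC hV hf ϖ hϖ h1 hκ hγ hγ' D
  have h0 : (0 : ℤ) ≤ padicValNat p ℓ := by exact_mod_cast Nat.zero_le _
  have hℓ0 : padicValNat p ℓ = 0 := by
    have : (padicValNat p ℓ : ℤ) ≤ 0 := by linarith
    omega
  have hcardeq : (padicValNat p (Nat.card (AddCommGroup.primaryComponent W.sha p)) : ℤ) = padicValRat p s := by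
    refine le_antisymm ?_ hlow
    have h := hle; rw [hℓ0, Nat.cast_zero, add_zero] at h; exact h
  have heq : (padicValNat p (Nat.card (AddCommGroup.primaryComponent W.sha p)) : ℤ) + padicValNat p ℓ =
      padicValRat p s := by rw [hℓ0, Nat.cast_zero, add_zero]; exact hcardeq
  exact ⟨⟨hmw, hfin, s, hs, hcardeq.symm⟩, hcardeq, g, u, ℓ, hiff.mpr heq, hι, hℓp,
    TameBranchFullSqueeze.eq_one_of_dvd_prime_sq_of_padicValNat_eq_zero hℓp hℓ0, heq⟩

end ClassLevel

end Summit.BirchSwinnertonDyer.Rank1Residual.Additive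

end
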